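import Summits.HodgeConjecture.HodgeConjecture.Theorems.PadicSemiregularLiftHodgeFermatVarietiesGeneralTwinLevelOne

/-!
# GP without the twin exclusion, V — the glue: L-twin for all `n''` at once and the row kill

Part 5 of 9 (Sketch Part 2 head, ll. 955–1038; namespace `…CancelByAnyClaimLattice.GenTwin`): `even_or_fibre_twin_any` (`p ≥ 11`, twin `p + 2` prime, `n ≥ 1` coprime
with primes `≥ 5`: Parts III/IV combined) and `false_of_row` (the row kill: if all `R = p + 1` entries of `α` (`∑ αᵢ = 0`) have the same reduction `u₀ ≠ 0` mod `p`
then `(p + 1) u₀ ≡ 0 (mod p)`, absurd).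

PROVENANCE. Cell hodge-nonav (HUMAN RULING D-0038), planner seat p1 g33: chapter ROUTE-P1AF addenda ADD4 ∕ ADD5 (memos `HOME/memos/ROUTE-P1AF-ADD4.md`
b7ad80a65555c84d, `…-ADD5.md` ffaf9911041dfeba; referee PASS 0∕0: ref g52 REF-P1AF-ADD4.md 83f6fe06da4ed38e, ref g53 REF-P1AF-ADD5.md bcccb0bceb665800),
frozen Sketch `HOME/p1/route/Sketch_P1AF_RGENTWIN_g33.lean` (sha16 596f05bb769cab0c, 1805 lines, namespaces `HodgeNonAV.P1AF.GenTwin` + the line's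
`…CancelByAnyClaimLattice.PairedNull ∕ .CoprimeSix`, farm rc 0 / 0 sorries / axioms {propext, Classical.choice, Quot.sound}; re-elaborated 2026-08-28), split into
nine tree modules `…GeneralTwinSplit` → `…GeneralTwinLocal` → `…GeneralTwinLevel` → `…GeneralTwinLevelOne` → `…GeneralTwinGlue` → `…FibreOfTopLevelGeneralTwinKey` → `…FibreOfTopLevelGeneralTwin` →
`…FibreOfProgressionGeneralTwin` → `…GeneralTwinPayoff` by planner p1 g34 (landing kit HOME/p1/landing/); proof bodies verbatim (cell namespace renamed
`…Theorems.CancelByAnyClaimLattice.GenTwin`); docstrings reworded per referee rider N-ADD4-1 (Aoki 1983 cites are METHOD attributions; the statements without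
the twin exclusion are not in print). Target: lead c4's `CoprimeSix.hodgeConjectureFor_general` (`Theorems/…GeneralPayoff`) WITHOUT the hypothesis
`htwin : ¬ p₁ (p₁+2) ∣ m` — replaced by `(p₁+2)² ∤ m`. Land with `--supports stmt-HodgeConjecture-1334` (line `cancel-by-any-claim-lattice` of crux
`HodgeFermatVarieties`, route `PadicSemiregularLift`). No instance, no new notation (the `local notation3` of Parts 2, 3 and 9 are the line's, verbatim from
`Theorems/PadicSemiregularLiftHodgeFermatVarietiesFibreOfBoundaryPow` ∕ `…GeneralPayoff`), no sorry, no new axiom.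
HONEST SCOPE: the HC pay-off `hodgeConjectureFor_general₂` is MODULO the line's named facts (S0) and stub statements (S2↑, S2↓, S3a, S5), exactly as c4's
`hodgeConjectureFor_general`; Fermat varieties are dominated by abelian motives (inside the known AV region); NOTHING here proves the Hodge conjecture.
References (method): N. Aoki, Math. Ann. 266 (1983) Thm A′ (§7), Prop. 2.2, Prop. 6.4, §9 [cite: Aoki1983, Thm. A]; N. Aoki, J. Math. Soc. Japan 39 (1987)
Thm 1-1, Thm 2-1 [cite: Aoki1987, Thm. 2-1]; T. Shioda, Proc. Japan Acad. 55 (1979) §2 Thm 1 [cite: Shioda1979PJA, Thm. 1].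
-/

set_option linter.dupNamespace false

noncomputable section

open Finset
open Literature.AlgebraicGeometry.HodgeTheory Literature.AlgebraicGeometry.HodgeTheory.FermatCharacter
open Summit.HodgeConjecture.HodgeConjecture.Theorems.CancelByAnyClaimLattice
open Summit.HodgeConjecture.HodgeConjecture.Theorems.CancelByAnyClaimLattice.PairedNull

namespace Summit.HodgeConjecture.HodgeConjecture.Theorems.CancelByAnyClaimLattice.GenTwin

/-- **L-twin, all `n''` at once** (`p ≥ 11`, twin `p + 2` prime, `n ≥ 1` coprime with primes `≥ 5`): `T` even, or a
full `(p+2)`-row over some `(u₀ mod p, b mod n)`, or a full `p`-column over some `(y₀ mod p+2, b mod n)` inside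
`supp T` — `even_or_fibre_twin_level` (`n ≠ 1`) and `even_or_fibre_twoPrime_one` (`n = 1`, where `11 ≤ p + 2`).
(statement: line `cancel-by-any-claim-lattice` ∕ cell hodge-nonav P1 g33; not in print) -/
theorem even_or_fibre_twin_any {p n N : ℕ} [Fact p.Prime] [Fact (p + 2).Prime] [NeZero n] [NeZero N]
    (hN : N = p * (p + 2) * n) (hpN : p ∣ N) (hrN : p + 2 ∣ N) (hnN : n ∣ N) (hp11 : 11 ≤ p)
    (hn5 : ∀ p' ∈ n.primeFactors, 5 ≤ p') (hc : (p * (p + 2)).Coprime n) (T : ZMod N → ℂ)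
    (h01 : ∀ z, T z = 0 ∨ T z = 1) (hTu : ∀ z, ¬ IsUnit z → T z = 0)
    (hT : ∀ χ : DirichletCharacter ℂ N, χ.Odd → χ.IsPrimitive → ∑ z, T z * χ z = 0)
    (hroom : ∀ p' ∈ n.primeFactors, #(univ.filter fun z : ZMod N ↦ T z ≠ 0) + 1 < p')
    (hsuppT : #(univ.filter fun z : ZMod N ↦ T z ≠ 0) ≤ p + 1) :
    (∀ z, T (-z) = T z) ∨
    (∃ b : ZMod n, IsUnit b ∧ ∃ u₀ : (ZMod p)ˣ, ∀ z : ZMod N, IsUnit z →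
        ZMod.castHom hpN (ZMod p) z = u₀ → ZMod.castHom hnN (ZMod n) z = b → T z ≠ 0) ∨
    (∃ b : ZMod n, IsUnit b ∧ ∃ y₀ : (ZMod (p + 2))ˣ, ∀ z : ZMod N, IsUnit z →
        ZMod.castHom hrN (ZMod (p + 2)) z = y₀ → ZMod.castHom hnN (ZMod n) z = b → T z ≠ 0) := by
  have hp5 : 5 ≤ p := le_trans (by norm_num) hp11
  by_cases hn1 : n = 1
  · subst hn1
    rw [mul_one] at hN
    subst hN
    have hpP : p.Prime := Fact.out
    have hrP : (p + 2).Prime := Fact.out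
    have hprc : p.Coprime (p + 2) := (Nat.coprime_primes hpP hrP).mpr (by omega)
    rcases even_or_fibre_twoPrime_one hp5 (by omega) (by omega) hprc T h01 hTu hT hsuppT with
      hev | ⟨u₀, hu⟩ | ⟨y₀, hy⟩
    · exact Or.inl hev
    · exact Or.inr (Or.inl ⟨1, isUnit_one, u₀, fun z hz hzu _ ↦ hu z hz hzu⟩)
    · exact Or.inr (Or.inr ⟨1, isUnit_one, y₀, fun z hz hzy _ ↦ hy z hz hzy⟩)
  · exact even_or_fibre_twin_level hN hpN hrN hnN hp5 hn1 hn5 hc T h01 hTu hT hroom hsuppT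

/-- **The row kill**: if all `R = p + 1` entries of `α` (`∑ αᵢ = 0`) have exact level `M`, `p ∣ M`, and their unit
parts are `≡ u₀ (mod p)` for one unit `u₀`, contradiction: dividing `∑ ⟨αᵢ⟩ ≡ 0 (mod m)` by `m / M` gives
`(p + 1) u₀ ≡ 0 (mod p)`. [folklore] -/
theorem false_of_row {m M p R : ℕ} [NeZero m] [NeZero M] (hp : p.Prime) (hpM : p ∣ M) (hMm : M ∣ m)
    (hRp : R = p + 1) {α : Fin R → ZMod m} (hsum : ∑ i, α i = 0)
    (hlev : ∀ i, m / m.gcd (α i).val = M) (u₀ : (ZMod p)ˣ)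
    (hrow : ∀ i, ZMod.castHom hpM (ZMod p) ((((α i).val / (m / M)) : ℕ) : ZMod M) = (u₀ : ZMod p)) :
    False := by
  haveI : Fact p.Prime := ⟨hp⟩
  have hM0 : M ≠ 0 := NeZero.ne M
  obtain ⟨d, hd⟩ := hMm
  have hd0 : d ≠ 0 := fun h0 ↦ NeZero.ne m (by rw [hd, h0, mul_zero])
  have hmM : m / M = d := by rw [hd, Nat.mul_div_cancel_left _ (Nat.pos_of_ne_zero hM0)]
  -- `d = m / M` divides every `⟨αᵢ⟩`
  have hdvd : ∀ i, d ∣ (α i).val := by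
    intro i
    have h1 : m / m.gcd (α i).val * m.gcd (α i).val = m := Nat.div_mul_cancel (Nat.gcd_dvd_left _ _)
    rw [hlev i] at h1
    have hgd : m.gcd (α i).val = d := Nat.eq_of_mul_eq_mul_left (Nat.pos_of_ne_zero hM0) (h1.trans hd)
    have h2 : m.gcd (α i).val ∣ (α i).val := Nat.gcd_dvd_right _ _
    rwa [hgd] at h2
  have hk : ∀ i, (α i).val = d * ((α i).val / d) := fun i ↦ (Nat.mul_div_cancel' (hdvd i)).symm
  -- `m ∣ ∑ ⟨αᵢ⟩`
  have hsumval : m ∣ ∑ i, (α i).val := by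
    rw [← ZMod.natCast_eq_zero_iff, Nat.cast_sum]
    simpa only [ZMod.natCast_zmod_val] using hsum
  -- `M ∣ ∑ ⟨αᵢ⟩ / d`, hence `p ∣` it
  have hMk : M ∣ ∑ i, (α i).val / d := by
    have hs : ∑ i, (α i).val = d * ∑ i, (α i).val / d := by
      rw [Finset.mul_sum]; exact Finset.sum_congr rfl fun i _ ↦ hk i
    have h2 : d * M ∣ d * ∑ i, (α i).val / d := by
      rw [← hs, mul_comm d M]
      exact (dvd_of_eq hd.symm).trans hsumval
    exact Nat.dvd_of_mul_dvd_mul_left (Nat.pos_of_ne_zero hd0) h2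
  have hpk : p ∣ ∑ i, (α i).val / d := hpM.trans hMk
  have hki : ∀ i, ((((α i).val / d : ℕ)) : ZMod p) = (u₀ : ZMod p) := by
    intro i
    have := hrow i
    rwa [hmM, map_natCast] at this
  have h0 : (∑ i, (((α i).val / d : ℕ) : ZMod p)) = 0 := by
    rw [← Nat.cast_sum, ZMod.natCast_eq_zero_iff]; exact hpk
  rw [Finset.sum_congr rfl fun i _ ↦ hki i, Finset.sum_const, Finset.card_univ, Fintype.card_fin, hRp,
    nsmul_eq_mul, Nat.cast_add, Nat.cast_one, ZMod.natCast_self, zero_add, one_mul] at h0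
  exact u₀.ne_zero h0

end Summit.HodgeConjecture.HodgeConjecture.Theorems.CancelByAnyClaimLattice.GenTwin

end
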